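import Literature.AlgebraicGeometry.Modules.PullbackAffineChart
import Literature.AlgebraicGeometry.Modules.Torsion
import Literature.AlgebraicGeometry.Modules.IsoOfSectionsOnBasis
import Mathlib.AlgebraicGeometry.Morphisms.ClosedImmersion
import HarnessLib

/-!
# `M ≅ j_* j^* M` for a closed immersion `j` and a module `M` killed by the ideal of `j`

Stacks Project, Tag 01QY (Morphisms, Lemma 29.4.1): for a closed immersion `j : Y → X` with ideal
sheaf `𝒦`, the functor `j_*` identifies quasi-coherent `𝒪_Y`-modules with quasi-coherent
`𝒪_X`-modules killed by `𝒦`; in particular **for a quasi-coherent `𝒪_X`-module `M` with `𝒦M = 0`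
the unit `M → j_* j^* M` is an isomorphism** (Hartshorne II Ex. 5.1 (d)–style computation on
affines: `Γ(j⁻¹V, j^*M) = Γ(V, 𝒪)/𝒦(V) ⊗_{Γ(V, 𝒪)} Γ(V, M) = Γ(V, M)`).

* `one_tmul_bijective_of_surjective` — the algebra: for a SURJECTIVE ring map `ψ : B → C` and a
  `B`-module `P` killed by `ker ψ`, `p ↦ 1 ⊗ p : P → C ⊗_B P` (Mathlib `extendScalars ψ`) is
  bijective; more generally (`one_tmul_bijective_of_section`) for any `ψ` admitting a set-theoretic
  section `σ` with `ker ψ · P = 0`... stated for surjective `ψ` (covers ring isomorphisms).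
* `isIso_unit_of_isKilledBy_ker` — the theorem, for `M` affine-localizing (the tree's
  quasi-coherence notion) killed by `j.ker` (`Modules/Torsion.IsKilledBy`), via the affine chart
  computation `Modules/PullbackAffineChart.unitSectionLE_bijective_of` and
  `isIso_of_bijective_app_of_isAffineOpen`.

Everything is proved; no named facts.

## References

* The Stacks Project, Tag 01QY (Morphisms, Lemma 29.4.1); Tag 01I8. [StacksProject]
* R. Hartshorne, *Algebraic Geometry*, GTM 52 (1977), II Prop. 5.2, Ex. 5.1. [Hartshorne1977]
* U. Görtz, T. Wedhorn, *Algebraic Geometry I*, 2nd ed. (2020), Prop. 7.24, Rem. 7.35. [GortzWedhorn2020]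
-/

noncomputable section

-- `TopCat.Presheaf`/`Scheme.Modules` are not reducible (as in Mathlib's `AlgebraicGeometry/Modules`).
set_option backward.isDefEq.respectTransparency false

open CategoryTheory AlgebraicGeometry Limits TopologicalSpace Opposite TensorProduct
open scoped ChangeOfRings

universe u

namespace Literature.AlgebraicGeometry.Modules

open Literature.AlgebraicGeometry.Motives

/-! ### Algebra: `P → C ⊗_B P` is bijective for `B ↠ C` with kernel killing `P` -/

section Algebra

variable {B C : Type u} [CommRing B] [CommRing C] (ψ : B →+* C) (P : ModuleCat.{u} B)

/-- In `C ⊗_B P`: `ψ(b) ⊗ p = 1 ⊗ b·p`. [folklore] -/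
theorem map_tmul_eq_one_tmul_smul (b : B) (p : P) :
    ((ψ b) ⊗ₜ[B, ψ] p : (ModuleCat.extendScalars.{u, u, u} ψ).obj P) = (1 : C) ⊗ₜ[B, ψ] (b • p) := by
  letI : Module B C := Module.compHom C ψ
  have h : (ψ b : C) = b • (1 : C) := by
    change ψ b = ψ b * 1
    rw [mul_one]
  rw [h]
  exact TensorProduct.smul_tmul b (1 : C) p

/-- **`p ↦ 1 ⊗ p : P → C ⊗_B P` is bijective** when `ψ : B → C` is surjective and `ker ψ` kills
`P` (e.g. `ψ` an isomorphism). [cite: StacksProject, Tag 01QY (proof)] -/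
theorem one_tmul_bijective_of_surjective (hψ : Function.Surjective ψ)
    (hK : ∀ b : B, ψ b = 0 → ∀ p : P, b • p = 0) :
    Function.Bijective
      (fun p : P => ((1 : C) ⊗ₜ[B, ψ] p : (ModuleCat.extendScalars.{u, u, u} ψ).obj P)) := by
  letI : Module B C := Module.compHom C ψ
  -- a set-theoretic section of `ψ`
  set σ : C → B := fun c => (hψ c).choose with hσ
  have hσψ : ∀ c, ψ (σ c) = c := fun c => (hψ c).choose_spec
  have hwd : ∀ (b b' : B), ψ b = ψ b' → ∀ p : P, b • p = b' • p := by
    intro b b' h p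
    have h0 := hK (b - b') (by rw [map_sub, h, sub_self]) p
    rwa [sub_smul, sub_eq_zero] at h0
  -- the inverse `c ⊗ p ↦ σ(c)·p`
  let g₂ : C →ₗ[B] P →ₗ[B] P :=
    LinearMap.mk₂ B (fun c p => σ c • p)
      (fun c c' p => by
        change σ (c + c') • p = σ c • p + σ c' • p
        rw [← add_smul]
        exact hwd _ _ (by rw [hσψ, map_add, hσψ, hσψ]) p)
      (fun b c p => by
        change σ (ψ b * c) • p = b • σ c • p
        rw [← mul_smul]
        exact hwd _ _ (by rw [hσψ, map_mul, hσψ]) p)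
      (fun c p p' => smul_add _ _ _)
      (fun b c p => smul_comm _ _ _)
  let g : TensorProduct B C P →ₗ[B] P := TensorProduct.lift g₂
  have hg : ∀ (c : C) (p : P),
      g (show TensorProduct B C P from (c ⊗ₜ[B, ψ] p : (ModuleCat.extendScalars.{u, u, u} ψ).obj P)) =
        σ c • p := fun c p =>
    TensorProduct.lift.tmul c p
  refine ⟨fun p p' h => ?_, fun x => ?_⟩
  · have h1 := congrArg (fun x : (ModuleCat.extendScalars.{u, u, u} ψ).obj P =>
      g (show TensorProduct B C P from x)) h
    simp only [hg] at h1
    rwa [hwd (σ 1) 1 (by rw [hσψ, map_one]) p, hwd (σ 1) 1 (by rw [hσψ, map_one]) p', one_smul,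
      one_smul] at h1
  · induction x using TensorProduct.induction_on with
    | zero => exact ⟨0, by simp only [TensorProduct.tmul_zero]⟩
    | tmul c p =>
      refine ⟨σ c • p, ?_⟩
      change (1 : C) ⊗ₜ[B, ψ] (σ c • p) = c ⊗ₜ[B, ψ] p
      rw [← map_tmul_eq_one_tmul_smul ψ P (σ c) p, hσψ]
    | add x y hx hy =>
      obtain ⟨p, hp⟩ := hx
      obtain ⟨p', hp'⟩ := hy
      exact ⟨p + p', by simp only [TensorProduct.tmul_add, hp, hp']⟩

end Algebra

/-! ### The unit `M → j_* j^* M` is an isomorphism for `M` killed by `𝒦 = ker j` -/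

section ClosedImmersion

variable {X Y : Scheme.{u}} (j : Y ⟶ X) [IsClosedImmersion j] (M : X.Modules)

/-- **The sections of the unit over an affine `V` are bijective**: `Γ(V, M) → Γ(j⁻¹V, j^*M)`,
`m ↦ η(m)`, for `M` affine-localizing killed by `ker j`. [cite: StacksProject, Tag 01QY] -/
theorem unit_app_bijective_of_isKilledBy_ker (hM : IsAffineLocalizing M) (hK : IsKilledBy j.ker M)
    {V : X.Opens} (hV : IsAffineOpen V) :
    Function.Bijective (((Scheme.Modules.pullbackPushforwardAdjunction j).unit.app M).app V) := by
  have hU : IsAffineOpen (j ⁻¹ᵁ V) := hV.preimage j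
  -- the unit at `V` is `unitSectionLE` for `i = le_rfl`
  have heq : (fun m => ((Scheme.Modules.pullbackPushforwardAdjunction j).unit.app M).app V m) =
      unitSectionLE j M (le_refl (j ⁻¹ᵁ V)) := by
    funext m
    change unitSection j M V m = ((Scheme.Modules.pullback j).obj M).presheaf.map (homOfLE _).op _
    rw [presheaf_map_congr _ (homOfLE (le_refl (j ⁻¹ᵁ V))) (𝟙 _), op_id,
      CategoryTheory.Functor.map_id]
    rfl
  change Function.Bijective (fun m => ((Scheme.Modules.pullbackPushforwardAdjunction j).unit.app M).app V m)
  rw [heq]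
  refine unitSectionLE_bijective_of j M hV (le_refl _) hU hM ?_
  -- the algebra: `j♯ : Γ(V) → Γ(j⁻¹V)` is surjective with kernel `𝒦(V)`, which kills `Γ(V, M)`
  have hψ : chartHom j (le_refl (j ⁻¹ᵁ V)) = j.app V := (Scheme.Hom.app_eq_appLE j).symm
  refine one_tmul_bijective_of_surjective (chartHom j (le_refl (j ⁻¹ᵁ V))).hom (restrictTop M hV)
    (by rw [hψ]; exact j.app_surjective V hV) fun b hb p => ?_
  rw [hψ] at hb
  have hb' : b ∈ j.ker.ideal ⟨V, hV⟩ := by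
    rw [Scheme.Hom.ker_apply]; exact hb
  -- `p` is a section of `M` over `fromSpec(⊤) = V`; the `Γ(V)`-action is the restricted one
  obtain ⟨m, rfl⟩ := (appTopRestrictFromSpecEquiv M hV).surjective p
  refine ((appTopRestrictFromSpecEquiv M hV).map_smul b m).symm.trans ?_
  rw [hK ⟨V, hV⟩ b hb' m, map_zero]

/-- **`M ≅ j_* j^* M` for a closed immersion `j` and `M` affine-localizing killed by `ker j`**: the
unit of `j^* ⊣ j_*` at `M` is an isomorphism (bijective on sections over every affine open).
[cite: StacksProject, Tag 01QY (Morphisms, Lemma 29.4.1)] -/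
theorem isIso_unit_of_isKilledBy_ker (hM : IsAffineLocalizing M) (hK : IsKilledBy j.ker M) :
    IsIso ((Scheme.Modules.pullbackPushforwardAdjunction j).unit.app M) :=
  isIso_of_bijective_app_of_isAffineOpen _ fun _ hV =>
    unit_app_bijective_of_isKilledBy_ker j M hM hK hV

/-- The isomorphism `M ≅ j_* j^* M`. [cite: StacksProject, Tag 01QY] -/
def unitIsoOfIsKilledBy (hM : IsAffineLocalizing M) (hK : IsKilledBy j.ker M) :
    M ≅ (Scheme.Modules.pushforward j).obj ((Scheme.Modules.pullback j).obj M) :=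
  haveI := isIso_unit_of_isKilledBy_ker j M hM hK
  asIso ((Scheme.Modules.pullbackPushforwardAdjunction j).unit.app M)

/-- `unitIsoOfIsKilledBy` is the unit. [folklore] -/
@[simp]
theorem unitIsoOfIsKilledBy_hom (hM : IsAffineLocalizing M) (hK : IsKilledBy j.ker M) :
    (unitIsoOfIsKilledBy j M hM hK).hom = (Scheme.Modules.pullbackPushforwardAdjunction j).unit.app M :=
  rfl

end ClosedImmersion

end Literature.AlgebraicGeometry.Modules

end
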